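import Mathlib.NumberTheory.SumTwoSquares
import Mathlib.NumberTheory.Padics.RingHoms
import Mathlib.NumberTheory.LegendreSymbol.QuadraticReciprocity
import Literature.NumberTheory.EllipticCurves.TwoIsogenySelmerGroup
import Literature.NumberTheory.EllipticCurves.BinaryQuarticLocalSolubility
import Literature.NumberTheory.EllipticCurves.BinaryQuarticBadReductionSolubilityProofs
import HarnessLib

/-!
# Route IsogenyRedei, crux `PencilSelmerDictionary` (stmt-Parity-11584), line
# `toric-node-vacuity-cassels`, Stub B: the dual-side homogeneous space
# `w² = 2u⁴ − 4t u²z² − 2z⁴` at the odd places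

For the pencil `E_t : y² = x³ + 2t x² + (t² + 1) x` the dual `2`-isogeny descent lives on the
divisors of `b' = (2t)² − 4(t² + 1) = −4`; the class `d = 2` of the dual Selmer set has homogeneous
space `w² = Q(u, z) := 2u⁴ − 4t u²z² − 2z⁴`, i.e.
`Q = Literature.NumberTheory.EllipticCurves.twoIsogenyQuartic (−4t) 2 (−2) = ⟨2, 0, −4t, 0, −2⟩`.
We prove (`stub_dualSideOddPlaces`): for every `t ≥ 1` and every odd prime `p`,

  `Q` is `ℚ_p`-soluble `↔` (`p ∣ t² + 1 → p ≡ 1 (mod 8)`),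

i.e. "`2` is a square modulo every prime factor of `t² + 1`".

* (`←`) If `p ∤ t² + 1` and `p ≥ 5` then `p ∤ disc Q = −2¹⁴ (t² + 1)²`, good reduction
  (`BinaryQuartic.isSoluble_padic_of_not_dvd_disc`). If `p = 3`: `Q(0, 1) = −2 ≡ 1² (mod 3)` is a
  point with nonzero `w`-coordinate, which lifts (Hensel at odd `p`,
  `BinaryQuartic.isSoluble_coe_of_smooth_zmod_point`). If `p ∣ t² + 1` and `p ≡ 1 (mod 8)` then
  `2 = c²` in `𝔽_p` (`ZMod.exists_sq_eq_two_iff`) and `Q(1, 0) = 2 = c²`, `c ≠ 0`, lifts likewise.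
* (`→`) Let `p ∣ t² + 1`, so `p ≡ 1 (mod 4)` and `τ := t mod p` satisfies `τ² = −1`; then
  `Q̄(u, z) = 2 (u² − τ z²)²` in `𝔽_p`. Reducing a `ℚ_p`-point modulo `p` (through the two affine
  charts of `ℙ¹(ℤ_p)`) gives `w² = Q̄(u, z)` with `(u, z) = (1, x)` or `(x, 1)`: either
  `A := u² − τ z² ≠ 0` and `2 = (w / A)²`, or `A = 0`, whence `x⁴ = −1` and `2 = (x − x³)²`.
  Either way `2` is a square mod `p`, so `p ≡ ±1 (mod 8)`, and `p ≡ 1 (mod 4)` leaves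
  `p ≡ 1 (mod 8)`.

The generic tools (reduction of a `ℚ_p`-point modulo `p`, Hensel at odd `p`, odd divisors of
`t² + 1` are `1 mod 4`) are private copies of the line's tool file
`IsogenyRedeiPencilSelmerDictionaryTools`.  Everything is proved; no definitions, no named facts.

## References

* J. H. Silverman, *The Arithmetic of Elliptic Curves*, 2nd ed., GTM 106 (2009), Prop. X.4.9 and
  Remark X.4.9.1 (descent via two-isogeny, the homogeneous spaces `C_d`).
* J. H. Silverman, J. Tate, *Rational Points on Elliptic Curves*, 2nd ed. (2015), §3.6.
-/

noncomputable section

open scoped Classical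

namespace Summit.Parity.BatemanHorn.Theorems.PencilSelmerDictionary

open Literature.NumberTheory.EllipticCurves
open Literature.NumberTheory.EllipticCurves.BinaryQuartic

/-! ## Private copies of the line's generic tools -/

/-- The discriminant of `⟨d, 0, a, 0, d'⟩` is `16 d d' (a² − 4 d d')²`. [folklore] -/
private theorem disc_twoIsogenyQuartic (a d d' : ℤ) :
    (twoIsogenyQuartic a d d').disc = 16 * d * d' * (a ^ 2 - 4 * d * d') ^ 2 := by
  simp only [twoIsogenyQuartic, BinaryQuartic.disc]
  ring

/-- Functoriality of `map` on integral forms: mapping along `ℤ → R → S` is mapping along `ℤ → S`.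
[folklore] -/
private theorem map_map_intCast {R S : Type*} [CommRing R] [CommRing S] (f : BinaryQuartic ℤ)
    (g : R →+* S) : (f.map (Int.castRingHom R)).map g = f.map (Int.castRingHom S) := by
  ext <;> simp [BinaryQuartic.map]

/-- **Reduction modulo `p` of a `ℚ_p`-point.** If the integral form `f` has a `ℚ_p`-point then
`w² = f(1, x)` or `w² = f(x, 1)` is soluble in `ZMod p` (scale the point into a chart of `ℙ¹(ℤ_p)`
and reduce). [folklore] -/
private theorem exists_zmod_prime_of_isSoluble_padic {p : ℕ} [Fact p.Prime] (f : BinaryQuartic ℤ)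
    (h : (f.map (Int.castRingHom ℚ_[p])).IsSoluble) :
    ∃ x w : ZMod p,
      w ^ 2 = (f.map (Int.castRingHom (ZMod p))).eval 1 x ∨
        w ^ 2 = (f.map (Int.castRingHom (ZMod p))).eval x 1 := by
  rw [← map_intCast_map_coe] at h
  have hφ : ∀ z u v : ℤ_[p],
      z ^ 2 = (f.map (Int.castRingHom ℤ_[p])).eval u v →
        (PadicInt.toZMod z) ^ 2 =
          (f.map (Int.castRingHom (ZMod p))).eval (PadicInt.toZMod u) (PadicInt.toZMod v) := by
    intro z u v hz
    have := congrArg (PadicInt.toZMod (p := p)) hz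
    rw [map_pow, ← eval_map, map_map_intCast] at this
    exact this
  rcases (isSoluble_map_coe_iff _).mp h with ⟨t, z, htz⟩ | ⟨t, z, htz⟩
  · refine ⟨PadicInt.toZMod t, PadicInt.toZMod z, Or.inl ?_⟩
    simpa using hφ z 1 t htz
  · refine ⟨PadicInt.toZMod t, PadicInt.toZMod z, Or.inr ?_⟩
    simpa using hφ z t 1 htz

/-- **`ℚ_p`-solubility from a unit square value modulo an odd prime**, for integral forms: if
`w² = f(x, 1)` in `ZMod p` with `w ≠ 0`, then `f` is `ℚ_p`-soluble (Hensel). [folklore] -/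
private theorem isSoluble_padic_of_zmod_sq {p : ℕ} [Fact p.Prime] (hp : p ≠ 2)
    (f : BinaryQuartic ℤ) {x w : ZMod p} (hw : w ≠ 0)
    (h : w ^ 2 = (f.map (Int.castRingHom (ZMod p))).eval x 1) :
    (f.map (Int.castRingHom ℚ_[p])).IsSoluble := by
  rw [← map_intCast_map_coe]
  refine isSoluble_coe_of_smooth_zmod_point hp (f.map (Int.castRingHom ℤ_[p])) (t := x) (z := w)
    ?_ (Or.inl hw)
  rw [map_map_intCast]
  exact h

/-- The same through the other chart: `w² = f(1, x)` in `ZMod p` with `w ≠ 0`. [folklore] -/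
private theorem isSoluble_padic_of_zmod_sq' {p : ℕ} [Fact p.Prime] (hp : p ≠ 2)
    (f : BinaryQuartic ℤ) {x w : ZMod p} (hw : w ≠ 0)
    (h : w ^ 2 = (f.map (Int.castRingHom (ZMod p))).eval 1 x) :
    (f.map (Int.castRingHom ℚ_[p])).IsSoluble := by
  -- pass to the reversed form `f(y, x)`
  have hrev : ((⟨f.e, f.d, f.c, f.b, f.a⟩ : BinaryQuartic ℤ).map
      (Int.castRingHom ℚ_[p])).IsSoluble := by
    refine isSoluble_padic_of_zmod_sq hp _ (x := x) (w := w) hw ?_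
    rw [h]
    simp only [BinaryQuartic.eval, BinaryQuartic.map]
    ring
  obtain ⟨u, v, z, huv, hz⟩ := hrev
  refine ⟨v, u, z, huv.symm, ?_⟩
  rw [hz]
  simp only [BinaryQuartic.eval, BinaryQuartic.map]
  ring

/-- An odd natural number dividing `t² + 1` is `≡ 1 (mod 4)`: `−1` is a square modulo it, so it is
a sum of two squares, one even and one odd. [folklore] -/
private theorem mod_four_eq_one_of_dvd_sq_add_one {d t : ℕ} (hodd : d % 2 = 1)
    (hdvd : d ∣ t ^ 2 + 1) : d % 4 = 1 := by
  have hsq : IsSquare (-1 : ZMod d) := by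
    refine ⟨(t : ZMod d), ?_⟩
    have h0 : ((t ^ 2 + 1 : ℕ) : ZMod d) = 0 := (ZMod.natCast_eq_zero_iff _ _).mpr hdvd
    push_cast at h0
    linear_combination -h0
  obtain ⟨x, y, hxy⟩ := Nat.eq_sq_add_sq_of_isSquare_mod_neg_one hsq
  rcases Nat.even_or_odd' x with ⟨a, rfl | rfl⟩ <;> rcases Nat.even_or_odd' y with ⟨b, rfl | rfl⟩
  · exfalso
    have : d = 4 * (a ^ 2 + b ^ 2) := by rw [hxy]; ring
    omega
  · have : d = 4 * (a ^ 2 + b ^ 2 + b) + 1 := by rw [hxy]; ring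
    omega
  · have : d = 4 * (a ^ 2 + a + b ^ 2) + 1 := by rw [hxy]; ring
    omega
  · exfalso
    have : d = 4 * (a ^ 2 + a + b ^ 2 + b) + 2 := by rw [hxy]; ring
    omega

/-- An odd prime factor of `t² + 1` is `≡ 1 (mod 4)`. [folklore] -/
private theorem prime_mod_four_eq_one_of_dvd_sq_add_one {p t : ℕ} (hp : p.Prime) (hp2 : p ≠ 2)
    (hdvd : p ∣ t ^ 2 + 1) : p % 4 = 1 :=
  mod_four_eq_one_of_dvd_sq_add_one (hp.eq_two_or_odd.resolve_left hp2) hdvd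

/-- In `ZMod p`, `p ∣ t² + 1` reads `(t : ZMod p)² = −1`. [folklore] -/
private theorem zmod_sq_eq_neg_one_of_dvd {p t : ℕ} (hdvd : p ∣ t ^ 2 + 1) :
    ((t : ZMod p)) ^ 2 = -1 := by
  have h0 : ((t ^ 2 + 1 : ℕ) : ZMod p) = 0 := (ZMod.natCast_eq_zero_iff _ _).mpr hdvd
  push_cast at h0
  linear_combination h0

/-! ## Two ways `2` becomes a square -/

/-- If `y⁴ = −1` then `2 = (y − y³)²` (the primitive eighth root of unity trick
`√2 = ζ₈ + ζ₈⁻¹`, with `ζ₈⁻¹ = −ζ₈³`). [folklore] -/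
private theorem isSquare_two_of_pow_four_eq_neg_one {F : Type*} [CommRing F] {y : F}
    (hy : y ^ 4 = -1) : IsSquare (2 : F) :=
  ⟨y - y ^ 3, by linear_combination (2 - y ^ 2) * hy⟩

/-- If `w² = 2 A²` with `A ≠ 0` in a field then `2 = (w / A)²` is a square. [folklore] -/
private theorem isSquare_two_of_sq_eq_two_mul_sq {F : Type*} [Field F] {w A : F} (hA : A ≠ 0)
    (h : w ^ 2 = 2 * A ^ 2) : IsSquare (2 : F) := by
  refine ⟨w * A⁻¹, ?_⟩
  have hinv : A * A⁻¹ = 1 := mul_inv_cancel₀ hA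
  linear_combination (-2 * (1 + A * A⁻¹)) * hinv + (-(A⁻¹) ^ 2) * h

/-! ## The stub -/

/-- **Dual side, odd places.** For `t ≥ 1` and an odd prime `p`, the homogeneous space
`w² = 2u⁴ − 4t u²z² − 2z⁴` of the class `2` of the dual `2`-isogeny descent of
`E_t : y² = x³ + 2t x² + (t² + 1) x` is `ℚ_p`-soluble iff (`p ∣ t² + 1 → p ≡ 1 (mod 8)`):
good reduction away from `2 (t² + 1)` (and the point `Q(0,1) = −2 ≡ 1 (mod 3)` at `p = 3`);
at `p ∣ t² + 1` the reduction is `Q̄ = 2 (u² − τ z²)²`, `τ² = −1`, which has a liftable point iff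
`2` is a square mod `p`, iff `p ≡ 1 (mod 8)` (as `p ≡ 1 (mod 4)`). [folklore] -/
theorem stub_dualSideOddPlaces :
    ∀ t : ℕ, 1 ≤ t → ∀ (p : ℕ) [Fact p.Prime], p ≠ 2 →
      (((twoIsogenyQuartic (-4 * (t : ℤ)) 2 (-2)).map (Int.castRingHom ℚ_[p])).IsSoluble ↔
        (p ∣ t ^ 2 + 1 → p % 8 = 1)) := by
  intro t _ p _ hp2
  have hp : p.Prime := Fact.out
  constructor
  · -- (→): reduce a `ℚ_p`-point modulo a prime `p ∣ t² + 1`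
    intro hsol hdvd
    have h41 : p % 4 = 1 := prime_mod_four_eq_one_of_dvd_sq_add_one hp hp2 hdvd
    suffices hsq : IsSquare (2 : ZMod p) by
      rcases (ZMod.exists_sq_eq_two_iff hp2).mp hsq with h | h <;> omega
    have hτ : ((t : ZMod p)) ^ 2 = -1 := zmod_sq_eq_neg_one_of_dvd hdvd
    -- the reduction of `Q` modulo `p` is `2 (u² − τ z²)²`
    have hev : ∀ u z : ZMod p,
        ((twoIsogenyQuartic (-4 * (t : ℤ)) 2 (-2)).map (Int.castRingHom (ZMod p))).eval u z =
          2 * (u ^ 2 - (t : ZMod p) * z ^ 2) ^ 2 := by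
      intro u z
      rw [eval_map_twoIsogenyQuartic]
      simp only [eq_intCast, Int.cast_mul, Int.cast_neg, Int.cast_ofNat, Int.cast_natCast]
      linear_combination (-2 * z ^ 4) * hτ
    obtain ⟨x, w, hxw⟩ := exists_zmod_prime_of_isSoluble_padic _ hsol
    rw [hev, hev] at hxw
    rcases hxw with h | h
    · -- chart `(u, z) = (1, x)`
      by_cases h0 : (1 : ZMod p) ^ 2 - (t : ZMod p) * x ^ 2 = 0
      · refine isSquare_two_of_pow_four_eq_neg_one (y := x) ?_
        linear_combination x ^ 4 * hτ + ((t : ZMod p) * x ^ 2 + 1) * h0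
      · exact isSquare_two_of_sq_eq_two_mul_sq h0 h
    · -- chart `(u, z) = (x, 1)`
      by_cases h0 : x ^ 2 - (t : ZMod p) * (1 : ZMod p) ^ 2 = 0
      · refine isSquare_two_of_pow_four_eq_neg_one (y := x) ?_
        linear_combination (x ^ 2 + (t : ZMod p)) * h0 + hτ
      · exact isSquare_two_of_sq_eq_two_mul_sq h0 h
  · -- (←): exhibit points modulo `p` with nonzero `w`-coordinate, or use good reduction
    intro H
    by_cases hdvd : p ∣ t ^ 2 + 1
    · -- `p ≡ 1 (mod 8)`: `2 = c²` and the point `(u : z : w) = (1 : 0 : c)`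
      obtain ⟨c, hc⟩ := (ZMod.exists_sq_eq_two_iff hp2).mpr (Or.inl (H hdvd))
      have h2 : (2 : ZMod p) ≠ 0 := by
        intro h
        have h' : ((2 : ℕ) : ZMod p) = 0 := by exact_mod_cast h
        rw [ZMod.natCast_eq_zero_iff] at h'
        exact hp2 ((Nat.prime_dvd_prime_iff_eq hp Nat.prime_two).mp h')
      have hc0 : c ≠ 0 := by
        rintro rfl
        exact h2 (by simpa using hc)
      refine isSoluble_padic_of_zmod_sq' hp2 _ (x := 0) (w := c) hc0 ?_
      rw [eval_map_twoIsogenyQuartic]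
      simp only [eq_intCast, Int.cast_mul, Int.cast_neg, Int.cast_ofNat, Int.cast_natCast]
      linear_combination -hc
    · by_cases hp3 : p = 3
      · -- `p = 3`: the point `(u : z : w) = (0 : 1 : 1)`, `Q(0, 1) = −2 ≡ 1 (mod 3)`
        have h3 : (3 : ZMod p) = 0 := by
          have h3' : ((3 : ℕ) : ZMod p) = 0 := by
            rw [ZMod.natCast_eq_zero_iff, hp3]
          exact_mod_cast h3'
        refine isSoluble_padic_of_zmod_sq hp2 _ (x := 0) (w := 1) one_ne_zero ?_
        rw [eval_map_twoIsogenyQuartic]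
        simp only [eq_intCast, Int.cast_mul, Int.cast_neg, Int.cast_ofNat, Int.cast_natCast]
        linear_combination h3
      · -- `p ≥ 5`, `p ∤ t² + 1`: good reduction, `disc Q = −2¹⁴ (t² + 1)²`
        have h5 : 5 ≤ p := hp.five_le_of_ne_two_of_ne_three hp2 hp3
        refine isSoluble_padic_of_not_dvd_disc h5 _ ?_
        have hdisc : (twoIsogenyQuartic (-4 * (t : ℤ)) 2 (-2)).disc =
            -((2 ^ 14 * (t ^ 2 + 1) ^ 2 : ℕ) : ℤ) := by
          rw [disc_twoIsogenyQuartic]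
          push_cast
          ring
        rw [hdisc, dvd_neg, Int.natCast_dvd_natCast]
        intro hd
        rcases (Nat.Prime.dvd_mul hp).mp hd with hd | hd
        · exact hp2 ((Nat.prime_dvd_prime_iff_eq hp Nat.prime_two).mp (hp.dvd_of_dvd_pow hd))
        · exact hdvd (hp.dvd_of_dvd_pow hd)

end Summit.Parity.BatemanHorn.Theorems.PencilSelmerDictionary

end
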